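import Summits.KontsevichZagierPeriods.KontsevichZagierPeriods.Theses.SpectatorSlicing
import Summits.KontsevichZagierPeriods.KontsevichZagierPeriods.Theorems.AyoubSpecialisationAssembly
import Literature.NumberTheory.Transcendental.KZKernelConjectureForms

/-!
# Redirect strategist r1 — where `CarrierRigidity` (stmt-KontsevichZagierPeriods-5240) sits relative to the summit

Sorry-free bookkeeping used by the r1 verdict (route `SpectatorSlicing`):

* `summit_iff_piCancellation_and_piLocalKernel` : the summit `KontsevichZagierPeriods` is EXACTLY the
  conjunction `KZ.PiCancellation ∧ KZ.PiLocalKernel` (tree theorems: `kzKernelConjecture_iff_isRational`,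
  `KZ.piLocalKernel_and_piCancellation_of_kernel`, `KZ.relations_le_ker_eval_holds`, and the π-peeling
  induction of `AyoubSpecialisationAssembly`). So the route is a CONJUNCT SPLIT of the summit.
* `carrierRigidity_of_piCancellation` / `piCancellation_of_carrierRigidity` : modulo the two
  provable-now supports `DiscIdeal` (5243) and `SpectatorDescent` (5242), the crux is the
  `PiCancellation` conjunct — hence a CONSEQUENCE of the summit (`carrierRigidity_of_summit`).
* `summit_of_carrierRigidity_iff` : modulo the same supports, "`CarrierRigidity → S`" is literally the
  implication `KZ.PiCancellation → KZ.PiLocalKernel`, i.e. the π-local kernel property (Ayoub 2014,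
  Conj. 7 for this calculus; ≈ Grothendieck period conjecture strength) — nothing in the tree or in
  print gives it, so no `C → S` is available: the crux is the conjunct WITHOUT the transcendence content.
-/

namespace Summit.KontsevichZagierPeriods.KontsevichZagierPeriods.Cruxes.CarrierRigidity.RedirectR1

open Literature.NumberTheory.Transcendental
open Summit.KontsevichZagierPeriods.KontsevichZagierPeriods.Theses.SpectatorSlicing

/-- `S → KZKernelConjecture` (tree: `kzKernelConjecture_iff_isRational`, rhs verbatim the summit body). -/
theorem kzKernel_of_summit (hS : KontsevichZagierPeriods) : KZKernelConjecture :=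
  kzKernelConjecture_iff_isRational.mpr hS

/-- `KZKernelConjecture → S`. -/
theorem summit_of_kzKernel (hK : KZKernelConjecture) : KontsevichZagierPeriods :=
  kzKernelConjecture_iff_isRational.mp hK

/-- **The summit is exactly the conjunction of the two π-localisation halves.** -/
theorem summit_iff_piCancellation_and_piLocalKernel :
    KontsevichZagierPeriods ↔ (KZ.PiCancellation ∧ KZ.PiLocalKernel) := by
  constructor
  · intro hS
    have h := KZ.piLocalKernel_and_piCancellation_of_kernel KZ.relations_le_ker_eval_holds
      (kzKernel_of_summit hS)
    exact ⟨h.2, h.1⟩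
  · rintro ⟨hPC, hPL⟩
    refine summit_of_kzKernel ?_
    exact Summit.KontsevichZagierPeriods.AyoubSpecialisation.kzKernelConjecture_of_piLocalKernel_of_piCancellation
      KZ.FormalRep.mul (KZ.of KZ.piRep) hPL hPC

/-- The route's `PiLocalKernel` item is the tree constant verbatim. -/
theorem piLocalKernel_item_iff : PiLocalKernel ↔ KZ.PiLocalKernel := Iff.rfl

/-- `S → PiCancellation` (the easy direction, in the tree as `KZ.piCancellation_of_kernel`). -/
theorem piCancellation_of_summit (hS : KontsevichZagierPeriods) : KZ.PiCancellation :=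
  (summit_iff_piCancellation_and_piLocalKernel.mp hS).1

/-- `S → PiLocalKernel` (exponent `N = 0`). -/
theorem piLocalKernel_of_summit (hS : KontsevichZagierPeriods) : KZ.PiLocalKernel :=
  (summit_iff_piCancellation_and_piLocalKernel.mp hS).2

/-- Modulo the support `DiscIdeal` (5243), `PiCancellation → CarrierRigidity`. -/
theorem carrierRigidity_of_piCancellation (hDI : DiscIdeal) (hPC : KZ.PiCancellation) :
    CarrierRigidity :=
  fun c hc => hDI c (hPC c hc)

/-- Modulo the support `SpectatorDescent` (5242), `CarrierRigidity → PiCancellation`. -/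
theorem piCancellation_of_carrierRigidity (hSD : SpectatorDescent) (hCR : CarrierRigidity) :
    KZ.PiCancellation :=
  fun c hc => hSD c (hCR c hc)

/-- **`S → C` (modulo `DiscIdeal`):** the crux is a consequence of the summit. -/
theorem carrierRigidity_of_summit (hDI : DiscIdeal) (hS : KontsevichZagierPeriods) : CarrierRigidity :=
  carrierRigidity_of_piCancellation hDI (piCancellation_of_summit hS)

/-- **What `C → S` would cost (modulo the two supports):** exactly `PiCancellation → PiLocalKernel`. -/
theorem summit_of_carrierRigidity_iff (hDI : DiscIdeal) (hSD : SpectatorDescent) :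
    (CarrierRigidity → KontsevichZagierPeriods) ↔ (KZ.PiCancellation → KZ.PiLocalKernel) := by
  constructor
  · intro h hPC
    exact piLocalKernel_of_summit (h (carrierRigidity_of_piCancellation hDI hPC))
  · intro h hCR
    have hPC := piCancellation_of_carrierRigidity hSD hCR
    exact summit_iff_piCancellation_and_piLocalKernel.mpr ⟨hPC, h hPC⟩

/-- The residual is load-bearing and NOT derivable inside the route: given the two supports and the
crux, the summit is equivalent to the residual `PiLocalKernel` alone. -/
theorem summit_iff_residual_of_crux (hSD : SpectatorDescent) (hCR : CarrierRigidity) :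
    KontsevichZagierPeriods ↔ KZ.PiLocalKernel :=
  ⟨piLocalKernel_of_summit,
    fun hPL => summit_iff_piCancellation_and_piLocalKernel.mpr
      ⟨piCancellation_of_carrierRigidity hSD hCR, hPL⟩⟩

/-- Conversely the crux is load-bearing too: given the residual and the descent support, the summit is
equivalent to the crux's content `PiCancellation`. -/
theorem summit_iff_piCancellation_of_residual (hPL : KZ.PiLocalKernel) :
    KontsevichZagierPeriods ↔ KZ.PiCancellation :=
  ⟨piCancellation_of_summit, fun hPC => summit_iff_piCancellation_and_piLocalKernel.mpr ⟨hPC, hPL⟩⟩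

/-- The spectator certificate subgroup (the closure set shared verbatim by `CarrierRigidity`,
`SpectatorDescent`, `DiscIdeal`) consists of relations: spectator changes of variables are instances of
move (2) and spectator Newton–Leibniz bands are instances of move (3) at dimension `2 + n`. Hence
`SpectatorDescent` is a CONSEQUENCE of the summit outright (no support needed). -/
theorem spectatorDescent_of_summit (hS : KontsevichZagierPeriods) : SpectatorDescent := by
  intro c hc
  have hK : KZKernelConjecture := kzKernel_of_summit hS
  -- the spectator closure sits inside `relations`
  have hmem : KZ.of KZ.piRep * c ∈ KZ.relations := by
    refine (AddSubgroup.closure_le KZ.relations).mpr ?_ hc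
    rintro x (((hx | hx) | hx) | hx)
    · exact KZ.domainAddRel_subset_relations hx
    · exact KZ.integrandAddRel_subset_relations hx
    · obtain ⟨n, r, r', Φ, Φ', hsa, hder, hinj, hdom, hjac, _hspec, rfl⟩ := hx
      exact KZ.changeOfVariablesRel_subset_relations ⟨n, r, r', Φ, Φ', hsa, hder, hinj, hdom, hjac, rfl⟩
    · obtain ⟨n, r, r', a, b, F, hF, ha, hb, hab, hdom, hcont, hder, hint, rfl⟩ := hx
      exact KZ.newtonLeibnizRel_subset_relations
        ⟨2 + n, r, r', a, b, F, hF, ha, hb, hab, hdom, hcont, hder, hint, rfl⟩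
  -- soundness: `eval ([π] * c) = π · eval c = 0`, so `eval c = 0`, and the kernel conjecture concludes
  exact hK c (KZ.eval_eq_zero_of_piRep_mul_mem_relations KZ.relations_le_ker_eval_holds hmem)

/-- **Joint strength of the cone (kernel-certified up to the provable-now support `DiscIdeal`).**
Given `DiscIdeal`, the summit is equivalent to the conjunction of the route\'s three `closes` binders:
the open items are JOINTLY the summit (a conjunct split), while `CarrierRigidity` alone is only the
`PiCancellation` conjunct. -/
theorem summit_iff_cone (hDI : DiscIdeal) :
    KontsevichZagierPeriods ↔ (CarrierRigidity ∧ SpectatorDescent ∧ PiLocalKernel) :=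
  ⟨fun hS => ⟨carrierRigidity_of_summit hDI hS, spectatorDescent_of_summit hS, piLocalKernel_of_summit hS⟩,
    fun h => closes h.1 h.2.1 h.2.2⟩

end Summit.KontsevichZagierPeriods.KontsevichZagierPeriods.Cruxes.CarrierRigidity.RedirectR1
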